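import Summits.QuantumFields.BalabanUV.Beta.D1BFx.RJetProjector
import Literature.MathematicalPhysics.QuantumFieldTheory.Balaban1983to89.Beta.EntrywiseVolumeLimit

/-!
# `BalabanUV.Beta.D1BFx.PeriodisedKernels` — road «BF-x» for binder row D1, slot (K), debt X₁a, brick **Q3b part 1** of `X1-SPEC.md`:
# THE ROAD'S ℤ⁴ KERNELS (`P`, `G′`, `G′Q′*Q′`, `−Δ`, `1[same block]`, `Δ′_a`) AS INPUTS OF an4's TWO-VARIABLE PERIODISATION — joint periodicity
# from block covariance, uniform row bounds from site/block decay, symmetry of the periodised matrix, the torus block structure read through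
# `ℕ`-representatives, and «a kernel that factors through the block of its column periodises to a matrix that kills block-mean-free vectors»

HONEST FRAMING (cell contract, verbatim): «discharging `BetaPertH` makes Bałaban's UV stability UNCONDITIONAL — a real constructive-QFT
result; it is NOT the continuum limit and NOT the Clay problem.»  HONEST DEPENDENCY (verbatim): «continuum YM on T⁴ ⇐ BetaPertH ∧ nine
spine estimates (0/9 proved); BetaPertH ⇐ (D1) ∧ (D4) ∧ CAP+tail; G-an2-4 gates asym, D1 and NE2/3/4.»  THIS MODULE DISCHARGES NOTHING of
D1 / BetaPertH: [folklore] bookkeeping BY NAME over an4's `Beta/EntrywiseVolumeLimit` (`Kernel₂`, `IsPeriodic₂`, `RowBound`, `periodise₂`,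
`periodise₂_eq_tsum_of_rep`), pv23's `B6QGQLower276`/`B5Hk103ScalarZd` (`AX`, `lapKer`, `sameBlk`, `blk`, `B`, `Gk`, `gq`, `abs_AX_le`, `abs_Gk_le`,
`abs_gq_le`, `summable_expX`, `tsum_expX_le`, `tsum_blocks`), the road's `RProjector` (`Pker`, `kerP`, `abs_Pker_le`, `abs_kerP_le`),
`RJetProjector` (`Pker_translate`, `gq_translate`, `kerP_translate`), `GhostLeg` (`Gk_translate`, `AX_translate`, `lapKer_translate`,
`sameBlk_translate`, `blk_translate`).  Three data `def`s with bodies ([our object]: `gsKer`, `valRep`, `tblk`); nothing is cited; 0 sorry.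
NOT summit progress; NOT BetaPertH, NOT continuum, NOT Clay.

ABSOLUTE RULE (cell, verbatim): «No internally-minted statement may enter as a cited fact. Every hypothesis is either kernel-proved in this
package or a verbatim quotation of a PUBLISHED theorem with page reference. The manuscript(s) under audit are NOT citable for their own
disputed steps — they are the thing under adjudication; programme-internal (2001/route/tribunal) claims are never citable.»

WHY (`HOME/b2b-balaban-beta-d1-p2/X1-SPEC.md` v1 §1 brick Q3b; owner claim ρ-g5-6, journal 2026-08-20T18:50Z).  On the periodisation road to X₁a
the torus gauge projector of an5 (`B5Value126.PcT`, B5 (1.26) form) is compared with the periodised road projector `P̂ = periodise₂ s Pker`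
(B9 (3.25) form) through the characterisation of `1 − P̂` as the orthogonal projector onto `Δ̂ N(Q̂′)` (part 2, `D1BFx/PeriodisedProjector`).
Every step of part 2 is an instance of an4's product rule `periodise₂_compKer` / Lemma 2.2.2, whose hypotheses are exactly: absolutely
summable rows of the left factor, joint `s·ℤ⁴`-periodicity and a uniform row bound of the right factor.  This file supplies those hypotheses
for the road's kernels ONCE (d = 4, pv23 block side `m + 1`, torus side `s` with `(m+1) ∣ s`), plus the three generic torus facts part 2
needs: the periodised matrix of a symmetric kernel is symmetric; the entries of `periodise₂ s (sameBlk m)` are the torus block indicator;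
and a kernel `K(p, r) = F(p, blk r)` periodises to a matrix whose action kills every vector with vanishing torus block sums.

CONTENT (all [folklore] / [our object]; `d = 4` because the translation lemmas of `GhostLeg`/`RJetProjector` are typed there).
* §1 `isPeriodic₂_of_blockCov` (block covariance under `side m • t` + `(m+1) ∣ s` ⟹ `IsPeriodic₂ s`), instances `isPeriodic₂_Pker/_Gk/_AX/_lapKer/
  _sameBlk`, the fine × fine reading `gsKer m a p q := gq m a p (blk m q)` of `G′Q′*Q′` with `gsKer_translate`, `isPeriodic₂_gsKer`.
* §2 `rowBound_of_site_decay`, `rowBound_of_blk_decay` (generic), instances `rowBound_AX/_Gk/_lapKer/_sameBlk/_Pker/_gsKer` and the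
  absolute row summabilities `summable_abs_row_*`.
* §3 `periodise₂_symm` (generic) and `periodise₂_symm_Pker/_Gk/_sameBlk`.
* §4 torus representatives `valRep`, `siteOf_valRep`, the torus block label `tblk m z := blk m (valRep z)` with `tblk_nonneg/_lt`
  (`0 ≤ tblk < s/(m+1)`), `blk_valRep_imageShift`, and **`periodise₂_sameBlk : periodise₂ s (sameBlk m) z z′ = if tblk m z = tblk m z′ then 1 else 0`**.
* §5 **`periodise₂_eq_of_tblk_eq`** (a jointly periodic row-summable kernel with `K p r = K p r′` whenever `blk r = blk r′` periodises to a
  matrix constant on torus blocks in the column) and **`sum_periodise₂_mul_eq_zero_of_blockMeanFree`** (its action kills every torus vector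
  whose torus block sums vanish).
Unit `b2b-balaban-beta-d1-p2` (road owner, gen 5).
-/

namespace Summit.QuantumFields.BalabanUV.Beta.D1BFx.PeriodisedKernels

open Finset
open scoped BigOperators
open Literature.MathematicalPhysics.QuantumFieldTheory.Balaban1983to89
open Literature.MathematicalPhysics.QuantumFieldTheory.Balaban1983to89.Beta
open B4Sect5Proof (latticeConst latticeConst_nonneg)
open B6QGQLower276 (X side blk B mem_B lapKer sameBlk AX AX_symm lapKer_symm sameBlk_symm abs_AX_le c0 c0_pos side_facts sum_B_const)
open B6QGQDecay237 (cU deltaU cU_pos deltaU_pos)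
open B5Hk103ScalarZd (Gk gq abs_gq_le abs_Gk_le summable_expX tsum_expX_le tsum_blocks)
open Summit.QuantumFields.BalabanUV.Beta.D1BFx.GhostLeg (Gk_translate AX_translate lapKer_translate sameBlk_translate blk_translate)
open Summit.QuantumFields.BalabanUV.Beta.D1BFx.RProjector (kerP Pker Pker_symm abs_Pker_le abs_kerP_le cPP deltaPP cPP_nonneg deltaPP_pos
  cP deltaP cP_nonneg deltaP_pos)
open Summit.QuantumFields.BalabanUV.Beta.D1BFx.RProjectorRange (Gk_symm summable_of_blk_majorant)
open Summit.QuantumFields.BalabanUV.Beta.D1BFx.RJetProjector (Pker_translate gq_translate kerP_translate)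

noncomputable section

/-! ## §1 Joint `s·ℤ⁴`-periodicity from block covariance -/

section Periodicity

variable (m : ℕ) {s : ℕ}

/-- [folklore] The image shift by `s·n`, `s = (m+1)·p`, is a block-lattice translation by `side m • (p•n)`. -/
theorem imageShift_eq_add_side_smul {p : ℕ} (hs : s = (m + 1) * p) (x n : X 4) :
    imageShift s x n = x + side m • ((p : ℤ) • n) := by
  funext i
  simp only [imageShift_apply, hs, Nat.cast_mul, Nat.cast_add, Nat.cast_one, Pi.add_apply, Pi.smul_apply, smul_eq_mul, side]
  ring

/-- [folklore] **BLOCK COVARIANCE ⟹ JOINT PERIODICITY**: a kernel invariant under the block-lattice translations `(p, q) ↦ (p + side m•t, q + side m•t)`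
is jointly `s·ℤ⁴`-periodic for every torus side `s` divisible by the block side `m + 1`. -/
theorem isPeriodic₂_of_blockCov (hdiv : m + 1 ∣ s) {K : Kernel₂ 4} (hK : ∀ t p q : X 4, K (p + side m • t) (q + side m • t) = K p q) :
    IsPeriodic₂ s K := by
  obtain ⟨p, hp⟩ := hdiv
  intro x y n
  rw [imageShift_eq_add_side_smul m hp, imageShift_eq_add_side_smul m hp]
  exact hK _ _ _

variable {a : ℝ}

/-- [folklore] `P` is jointly `s·ℤ⁴`-periodic (`RJetProjector.Pker_translate`). -/
theorem isPeriodic₂_Pker (ha : 0 < a) (hdiv : m + 1 ∣ s) : IsPeriodic₂ s (Pker (d := 4) m a) :=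
  isPeriodic₂_of_blockCov m hdiv fun t p q => Pker_translate m ha t p q

/-- [folklore] `G′` is jointly `s·ℤ⁴`-periodic (`GhostLeg.Gk_translate`). -/
theorem isPeriodic₂_Gk (ha : 0 < a) (hdiv : m + 1 ∣ s) : IsPeriodic₂ s (Gk (d := 4) m a) :=
  isPeriodic₂_of_blockCov m hdiv fun t p q => Gk_translate a m ha t p q

/-- [folklore] `Δ′_a` is jointly `s·ℤ⁴`-periodic (`GhostLeg.AX_translate`). -/
theorem isPeriodic₂_AX (a : ℝ) (hdiv : m + 1 ∣ s) : IsPeriodic₂ s (AX (d := 4) m a) :=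
  isPeriodic₂_of_blockCov m hdiv fun t p q => AX_translate a m p q t

/-- [folklore] `−Δ` is jointly `s·ℤ⁴`-periodic (translation invariant). -/
theorem isPeriodic₂_lapKer (s : ℕ) : IsPeriodic₂ s (lapKer (d := 4)) :=
  IsPeriodic₂.of_transInv (fun x y v => lapKer_translate x y v) s

/-- [folklore] `1[same block]` is jointly `s·ℤ⁴`-periodic (`GhostLeg.sameBlk_translate`). -/
theorem isPeriodic₂_sameBlk (hdiv : m + 1 ∣ s) : IsPeriodic₂ s (sameBlk (d := 4) m) :=
  isPeriodic₂_of_blockCov m hdiv fun t p q => sameBlk_translate m p q t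

/-- [our object] **`G′Q′*Q′` READ AS A FINE × FINE KERNEL**: `gsKer m a p q := (G′Q′*)(p, blk q)` — the kernel of `G′ ∘ 1[same block]`, whose range
on any torus is the range of `Ĝ′Q̂′*` (part 2). -/
def gsKer (m : ℕ) (a : ℝ) (p q : X 4) : ℝ := gq m a p (blk m q)

/-- [folklore] Block covariance of `gsKer` (`gq_translate` + `blk_translate`). -/
theorem gsKer_translate (ha : 0 < a) (t p q : X 4) : gsKer m a (p + side m • t) (q + side m • t) = gsKer m a p q := by
  simp only [gsKer, blk_translate, gq_translate m ha]

/-- [folklore] `gsKer` is jointly `s·ℤ⁴`-periodic. -/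
theorem isPeriodic₂_gsKer (ha : 0 < a) (hdiv : m + 1 ∣ s) : IsPeriodic₂ s (gsKer m a) :=
  isPeriodic₂_of_blockCov m hdiv fun t p q => gsKer_translate m ha t p q

end Periodicity

/-! ## §2 Uniform row bounds from site decay and from block decay -/

section RowBounds

variable (m : ℕ) {a : ℝ}

/-- [folklore] **SITE DECAY ⟹ ROW BOUND**: `|K(p,q)| ≤ C e^{−δ·dist(p,q)}` gives absolutely summable rows with `Σ_q |K(p,q)| ≤ C·K_4(δ)`. -/
theorem rowBound_of_site_decay {K : Kernel₂ 4} {C δ : ℝ} (hδ : 0 < δ) (hC : 0 ≤ C)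
    (h : ∀ p q : X 4, |K p q| ≤ C * Real.exp (-(δ * dist p q))) : RowBound K (C * latticeConst 4 δ) := by
  intro p
  have hs : Summable fun q : X 4 => |K p q| :=
    Summable.of_nonneg_of_le (fun q => abs_nonneg _) (fun q => h p q) ((summable_expX hδ p).mul_left C)
  refine ⟨hs, ?_⟩
  calc ∑' q, |K p q| ≤ ∑' q : X 4, C * Real.exp (-(δ * dist p q)) := hs.tsum_le_tsum (fun q => h p q) ((summable_expX hδ p).mul_left C)
    _ = C * ∑' q : X 4, Real.exp (-(δ * dist p q)) := tsum_mul_left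
    _ ≤ C * latticeConst 4 δ := mul_le_mul_of_nonneg_left (tsum_expX_le hδ p) hC

/-- [folklore] **BLOCK DECAY ⟹ ROW BOUND**: `|K(p,q)| ≤ C e^{−δ·dist(blk p, blk q)}` gives absolutely summable rows with
`Σ_q |K(p,q)| ≤ (m+1)⁴·C·K_4(δ)` (block by block: `(m+1)⁴` sites per block, `B5Hk103ScalarZd.tsum_blocks`). -/
theorem rowBound_of_blk_decay {K : Kernel₂ 4} {C δ : ℝ} (hδ : 0 < δ) (hC : 0 ≤ C)
    (h : ∀ p q : X 4, |K p q| ≤ C * Real.exp (-(δ * dist (blk m p) (blk m q)))) :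
    RowBound K (((m : ℝ) + 1) ^ 4 * C * latticeConst 4 δ) := by
  intro p
  have hs : Summable fun q : X 4 => |K p q| :=
    summable_of_blk_majorant m hδ (blk m p) fun q => by rw [abs_abs]; exact h p q
  refine ⟨hs, ?_⟩
  have hblk : ∀ w : X 4, ∑ q ∈ B m w, |K p q| ≤ ((m : ℝ) + 1) ^ 4 * C * Real.exp (-(δ * dist (blk m p) w)) := by
    intro w
    calc ∑ q ∈ B m w, |K p q| ≤ ∑ q ∈ B m w, C * Real.exp (-(δ * dist (blk m p) w)) :=
          Finset.sum_le_sum fun q hq => by have := h p q; rwa [mem_B.1 hq] at this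
      _ = ((m : ℝ) + 1) ^ 4 * C * Real.exp (-(δ * dist (blk m p) w)) := by rw [sum_B_const]; ring
  have hmaj : Summable fun w : X 4 => ((m : ℝ) + 1) ^ 4 * C * Real.exp (-(δ * dist (blk m p) w)) :=
    (summable_expX hδ (blk m p)).mul_left _
  have hbs : Summable fun w : X 4 => ∑ q ∈ B m w, |K p q| :=
    Summable.of_nonneg_of_le (fun w => Finset.sum_nonneg fun q _ => abs_nonneg _) hblk hmaj
  calc ∑' q, |K p q| = ∑' w : X 4, ∑ q ∈ B m w, |K p q| := (tsum_blocks m hs).symm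
    _ ≤ ∑' w : X 4, ((m : ℝ) + 1) ^ 4 * C * Real.exp (-(δ * dist (blk m p) w)) := hbs.tsum_le_tsum hblk hmaj
    _ = ((m : ℝ) + 1) ^ 4 * C * ∑' w : X 4, Real.exp (-(δ * dist (blk m p) w)) := tsum_mul_left
    _ ≤ ((m : ℝ) + 1) ^ 4 * C * latticeConst 4 δ :=
        mul_le_mul_of_nonneg_left (tsum_expX_le hδ (blk m p)) (by positivity)

/-- [folklore] Row bound of `Δ′_a` (`B6QGQLower276.abs_AX_le`: site decay at rate 1). -/
theorem rowBound_AX (ha : 0 < a) : RowBound (AX (d := 4) m a) (c0 4 m a * latticeConst 4 1) :=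
  rowBound_of_site_decay one_pos (c0_pos 4 m ha.ne').le fun p q => abs_AX_le m a p q

/-- [folklore] Row bound of `G′` (`B5Hk103ScalarZd.abs_Gk_le`: site decay at rate `δ_u/(m+1)`). -/
theorem rowBound_Gk (ha : 0 < a) :
    RowBound (Gk (d := 4) m a) (2 / min 2 a * latticeConst 4 (deltaU 4 a / ((m : ℝ) + 1))) := by
  refine rowBound_of_site_decay (div_pos (deltaU_pos 4 ha) (by positivity)) ?_ fun p q => ?_
  · have : 0 < min 2 a := lt_min two_pos ha
    positivity
  · have h := abs_Gk_le m ha p q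
    rwa [show deltaU 4 a * (dist p q / ((m : ℝ) + 1)) = deltaU 4 a / ((m : ℝ) + 1) * dist p q by ring] at h

/-- [folklore] `−Δ = (m+1)^{−2}·Δ′_0`-type bound: `|(−Δ)(p,q)| ≤ c₀(4,m,0)/(m+1)²·e^{−dist(p,q)}` from `abs_AX_le` at `a = 0`. -/
theorem abs_lapKer_le (p q : X 4) : |lapKer p q| ≤ c0 4 m 0 / ((m : ℝ) + 1) ^ 2 * Real.exp (-(1 * dist p q)) := by
  have h := abs_AX_le m (0 : ℝ) p q
  have hm : (0 : ℝ) < ((m : ℝ) + 1) ^ 2 := by positivity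
  have e : AX m (0 : ℝ) p q = ((m : ℝ) + 1) ^ 2 * lapKer p q := by simp [AX]
  rw [e, abs_mul, abs_of_pos hm] at h
  rw [div_mul_eq_mul_div, le_div_iff₀ hm]
  linarith

/-- [folklore] `c₀(4, m, 0) ≥ 0` (the constant of `abs_AX_le` at `a = 0`; `c0_pos` wants `a ≠ 0`). -/
theorem c0_zero_nonneg : 0 ≤ c0 4 m 0 := by unfold c0; positivity

/-- [folklore] Row bound of `−Δ`. -/
theorem rowBound_lapKer : RowBound (lapKer (d := 4)) (c0 4 m 0 / ((m : ℝ) + 1) ^ 2 * latticeConst 4 1) :=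
  rowBound_of_site_decay one_pos (div_nonneg (c0_zero_nonneg m) (by positivity)) fun p q => abs_lapKer_le m p q

/-- [folklore] Row bound of `1[same block]` (block decay with constant `1`, any rate). -/
theorem rowBound_sameBlk : RowBound (sameBlk (d := 4) m) (((m : ℝ) + 1) ^ 4 * 1 * latticeConst 4 1) := by
  refine rowBound_of_blk_decay m one_pos zero_le_one fun p q => ?_
  by_cases h : blk m p = blk m q
  · rw [sameBlk, if_pos h, h, dist_self, mul_zero, neg_zero, Real.exp_zero, abs_one, mul_one]
  · rw [sameBlk, if_neg h, abs_zero, one_mul]; exact (Real.exp_pos _).le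

/-- [folklore] Row bound of `P` (`RProjector.abs_Pker_le`: block decay). -/
theorem rowBound_Pker (ha : 0 < a) :
    RowBound (Pker (d := 4) m a) (((m : ℝ) + 1) ^ 4 * cPP 4 m a * latticeConst 4 (deltaPP 4 a)) :=
  rowBound_of_blk_decay m (deltaPP_pos 4 ha) (cPP_nonneg 4 m ha) fun p q => abs_Pker_le m ha p q

/-- [folklore] Row bound of `gsKer = G′Q′*Q′` (`B5Hk103ScalarZd.abs_gq_le`: block decay). -/
theorem rowBound_gsKer (ha : 0 < a) :
    RowBound (gsKer m a) (((m : ℝ) + 1) ^ 4 * (cU 4 a * Real.sqrt (((m : ℝ) + 1) ^ 4)) * latticeConst 4 (deltaU 4 a)) :=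
  rowBound_of_blk_decay m (deltaU_pos 4 ha) (by have := cU_pos 4 ha; positivity) fun p q => abs_gq_le m ha p (blk m q)

/-- [folklore] Absolutely summable rows, unpacked (the left-factor hypothesis of `periodise₂_compKer`). -/
theorem summable_abs_row_Pker (ha : 0 < a) (p : X 4) : Summable fun q => |Pker (d := 4) m a p q| := (rowBound_Pker m ha).summable_abs p

/-- [folklore] Absolutely summable rows of `G′`. -/
theorem summable_abs_row_Gk (ha : 0 < a) (p : X 4) : Summable fun q => |Gk (d := 4) m a p q| := (rowBound_Gk m ha).summable_abs p

/-- [folklore] Absolutely summable rows of `Δ′_a`. -/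
theorem summable_abs_row_AX (ha : 0 < a) (p : X 4) : Summable fun q => |AX (d := 4) m a p q| := (rowBound_AX m ha).summable_abs p

end RowBounds

/-! ## §3 The periodised matrix of a symmetric kernel is symmetric -/

section Symmetry

variable {d s : ℕ} [NeZero s]

/-- [folklore] **SYMMETRY SURVIVES PERIODISATION**: a jointly `s·ℤ^d`-periodic, row-summable, symmetric kernel has a symmetric periodised
matrix (`K̂(y,x) = Σ_n K(ŷ, x̂ + sn) = Σ_n K(x̂ + sn, ŷ) = Σ_n K(x̂, ŷ − sn)`). -/
theorem periodise₂_symm {K : Kernel₂ d} (hK : IsPeriodic₂ s K) (hsym : ∀ x y, K x y = K y x)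
    (x y : Site d s) : periodise₂ s K x y = periodise₂ s K y x := by
  have h1 : periodise₂ s K y x = ∑' n : Fin d → ℤ, K (windowMap d s x) (imageShift s (windowMap d s y) (-n)) := by
    unfold periodise₂
    refine tsum_congr fun n => ?_
    rw [hsym]
    have h := hK (windowMap d s x) (imageShift s (windowMap d s y) (-n)) n
    rw [imageShift_add, neg_add_cancel, imageShift_zero] at h
    exact h
  rw [h1]
  exact ((Equiv.neg (Fin d → ℤ)).tsum_eq (fun n => K (windowMap d s x) (imageShift s (windowMap d s y) n))).symm

end Symmetry

/-! ## §4 Torus representatives in `[0, s)^4`, the torus block label, and the periodised block indicator -/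

section TorusBlocks

variable (m : ℕ) {s : ℕ} [NeZero s]

/-- [our object] The representative of a torus point in `[0, s)^4` (`ZMod.val` coordinatewise). -/
def valRep (z : Site 4 s) : X 4 := fun i => ((z i).val : ℤ)

/-- [folklore] `valRep` is a representative. -/
theorem siteOf_valRep (z : Site 4 s) : siteOf 4 s (valRep z) = z := by
  funext i; simp [siteOf, valRep]

omit [NeZero s] in
/-- [folklore] `0 ≤ valRep z i`. -/
theorem valRep_nonneg (z : Site 4 s) (i : Fin 4) : 0 ≤ valRep z i := by
  simp only [valRep]; exact Int.natCast_nonneg _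

/-- [folklore] `valRep z i < s`. -/
theorem valRep_lt (z : Site 4 s) (i : Fin 4) : valRep z i < (s : ℤ) := by
  simp only [valRep]; exact_mod_cast ZMod.val_lt (z i)

/-- [our object] **THE TORUS BLOCK LABEL** `tblk m z := blk m (valRep z) ∈ [0, s/(m+1))^4`. -/
def tblk (z : Site 4 s) : X 4 := blk m (valRep z)

omit [NeZero s] in
/-- [folklore] `0 ≤ tblk m z i`. -/
theorem tblk_nonneg (z : Site 4 s) (i : Fin 4) : 0 ≤ tblk m z i :=
  Int.ediv_nonneg (valRep_nonneg z i) (side_facts m).1.le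

/-- [folklore] `tblk m z i < p` when `s = (m+1)·p`. -/
theorem tblk_lt {p : ℕ} (hs : s = (m + 1) * p) (z : Site 4 s) (i : Fin 4) : tblk m z i < (p : ℤ) := by
  have hs' : (s : ℤ) = ((m : ℤ) + 1) * (p : ℤ) := by rw [hs]; push_cast; ring
  have h := valRep_lt z i
  rw [hs'] at h
  show valRep z i / side m < (p : ℤ)
  rw [Int.ediv_lt_iff_lt_mul (side_facts m).1, side]
  linarith

omit [NeZero s] in
/-- [folklore] Block labels of the images of a representative: `blk (valRep z + s·n) = tblk m z + p•n`. -/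
theorem blk_valRep_imageShift {p : ℕ} (hs : s = (m + 1) * p) (z : Site 4 s) (n : X 4) :
    blk m (imageShift s (valRep z) n) = tblk m z + (p : ℤ) • n := by
  rw [imageShift_eq_add_side_smul m hs, blk_translate, tblk]

omit [NeZero s] in
/-- [folklore] `p ≠ 0` when `s = (m+1)·p ≠ 0`. -/
theorem p_pos_of_hs [NeZero s] {p : ℕ} (hs : s = (m + 1) * p) : 0 < (p : ℤ) := by
  have : p ≠ 0 := fun h => NeZero.ne s (by rw [hs, h, mul_zero])
  exact_mod_cast Nat.pos_of_ne_zero this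

/-- [folklore] **THE PERIODISED BLOCK INDICATOR IS THE TORUS BLOCK INDICATOR**: `periodise₂ s (sameBlk m) z z′ = 1[tblk z = tblk z′]`. -/
theorem periodise₂_sameBlk {p : ℕ} (hs : s = (m + 1) * p) (z z' : Site 4 s) :
    periodise₂ s (sameBlk (d := 4) m) z z' = if tblk m z = tblk m z' then 1 else 0 := by
  have hdiv : m + 1 ∣ s := ⟨p, hs⟩
  rw [periodise₂_eq_tsum_of_rep (isPeriodic₂_sameBlk m hdiv) (rowBound_sameBlk m).summable (siteOf_valRep z) (siteOf_valRep z')]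
  have e : ∀ n : X 4, sameBlk m (valRep z) (imageShift s (valRep z') n) = if tblk m z = tblk m z' + (p : ℤ) • n then 1 else 0 := by
    intro n; rw [sameBlk, blk_valRep_imageShift m hs]; rfl
  rw [tsum_congr e, tsum_eq_single 0]
  · simp
  · intro n hn
    rw [if_neg]
    intro h
    apply hn
    funext i
    have hi := congr_fun h i
    simp only [Pi.add_apply, Pi.smul_apply, smul_eq_mul] at hi
    have h1 := tblk_nonneg m z i
    have h2 := tblk_lt m hs z i
    have h3 := tblk_nonneg m z' i
    have h4 := tblk_lt m hs z' i
    have hp := p_pos_of_hs m hs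
    -- `|n i| · p ≤ |tblk z i − tblk z' i| < p` forces `n i = 0`
    show n i = 0
    rcases lt_trichotomy (n i) 0 with hlt | heq | hgt
    · have : (p : ℤ) * n i ≤ (p : ℤ) * (-1) := mul_le_mul_of_nonneg_left (by omega) hp.le
      linarith
    · exact heq
    · have : (p : ℤ) * 1 ≤ (p : ℤ) * n i := mul_le_mul_of_nonneg_left (by omega) hp.le
      linarith

end TorusBlocks

/-! ## §5 Kernels that factor through the block of their column -/

section BlockFactored

variable (m : ℕ) {s : ℕ} [NeZero s]

/-- [folklore] **A KERNEL CONSTANT ON BLOCKS IN ITS COLUMN PERIODISES TO A MATRIX CONSTANT ON TORUS BLOCKS IN ITS COLUMN.** -/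
theorem periodise₂_eq_of_tblk_eq {K : Kernel₂ 4} (hK : IsPeriodic₂ s K) (hrow : ∀ x, Summable (K x)) {p : ℕ} (hs : s = (m + 1) * p)
    (hfac : ∀ x r r' : X 4, blk m r = blk m r' → K x r = K x r') (x : Site 4 s) {z z' : Site 4 s} (h : tblk m z = tblk m z') :
    periodise₂ s K x z = periodise₂ s K x z' := by
  rw [periodise₂_eq_tsum_of_rep hK hrow (siteOf_windowMap 4 s x) (siteOf_valRep z),
    periodise₂_eq_tsum_of_rep hK hrow (siteOf_windowMap 4 s x) (siteOf_valRep z')]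
  refine tsum_congr fun n => hfac _ _ _ ?_
  rw [blk_valRep_imageShift m hs, blk_valRep_imageShift m hs, h]

/-- [folklore] **… AND ITS ACTION KILLS EVERY TORUS VECTOR WITH VANISHING TORUS BLOCK SUMS** (`Σ_z K̂(x,z)·λ(z) = 0` whenever
`Σ_{z ∈ torus block} λ(z) = 0` for every torus block). -/
theorem sum_periodise₂_mul_eq_zero_of_blockMeanFree {K : Kernel₂ 4} (hK : IsPeriodic₂ s K) (hrow : ∀ x, Summable (K x))
    {p : ℕ} (hs : s = (m + 1) * p) (hfac : ∀ x r r' : X 4, blk m r = blk m r' → K x r = K x r')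
    {lam : Site 4 s → ℝ} (hlam : ∀ z₀ : Site 4 s, ∑ z ∈ Finset.univ.filter (fun z => tblk m z = tblk m z₀), lam z = 0)
    (x : Site 4 s) : ∑ z, periodise₂ s K x z * lam z = 0 := by
  classical
  rw [← Finset.sum_fiberwise_of_maps_to
    (fun z (_ : z ∈ (Finset.univ : Finset (Site 4 s))) => Finset.mem_image_of_mem (tblk m) (Finset.mem_univ z))]
  refine Finset.sum_eq_zero fun b hb => ?_
  obtain ⟨z₀, -, hz₀⟩ := Finset.mem_image.1 hb
  have e : ∀ z ∈ Finset.univ.filter (fun z => tblk m z = b), periodise₂ s K x z * lam z = periodise₂ s K x z₀ * lam z := by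
    intro z hz
    rw [periodise₂_eq_of_tblk_eq m hK hrow hs hfac x ((Finset.mem_filter.1 hz).2.trans hz₀.symm)]
  rw [Finset.sum_congr rfl e, ← Finset.mul_sum]
  have hset : (Finset.univ : Finset (Site 4 s)).filter (fun z => tblk m z = b)
      = (Finset.univ : Finset (Site 4 s)).filter (fun z => tblk m z = tblk m z₀) := by rw [hz₀]
  rw [hset, hlam z₀, mul_zero]

end BlockFactored

end

end Summit.QuantumFields.BalabanUV.Beta.D1BFx.PeriodisedKernels
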